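import Mathlib
import Literature.NumberTheory.Transcendental.BeukersZetaThreeIntegrals
import HarnessLib

/-!
# Beukers' integral identity for `ζ(3)` — proof of AAR Lemma 7.7.4 / (7.7.3)

Sibling proof file of `BeukersZetaThreeIntegrals.lean` (next to `BeukersZetaThreeIntegralsProofs.lean`,
`I_0 = 2ζ(3)`, and `BeukersZetaThreeIntegralsOffDiagProofs.lean`, Lemma 7.7.3 off-diagonal). It discharges
the named fact `Beukers.legendreLogIntegral_eq_tripleIntegral`:
`∫∫_{(0,1)²} -log(xy)/(1-xy) · pₙ(x)pₙ(y) = ∫∫∫_{(0,1)³} (x(1-x)y(1-y)w(1-w))ⁿ/(1-(1-xy)w)ⁿ⁺¹`,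
`pₙ` = `Polynomial.shiftedLegendre n`, following the printed proof (Andrews–Askey–Roy,
*Special Functions*, §7.7, proof of Lemma 7.7.4, p. 392; Beukers 1979):

1. `-log(xy)/(1-xy) = ∫₀¹ dz/(1-(1-xy)z)` (`integral_one_div_one_sub_mul`), so the left side is
   the integral of `F₁ = pₙ(x)pₙ(y)/(1-(1-xy)z)` over the open unit cube (Fubini);
2. `n` integrations by parts in `x` (`integral_shiftedLegendre_div_linear`, from the `m`-fold
   formula `integral_deriv_iterate_mul_eq` and Rodrigues' formula
   `Polynomial.factorial_mul_shiftedLegendre_eq`) turn `F₁` into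
   `F₂ = (xyz)ⁿ(1-x)ⁿpₙ(y)/(1-(1-xy)z)ⁿ⁺¹`;
3. the substitution `w = (1-z)/(1-(1-xy)z)` (`integral_substitution_beukers`) turns `F₂` into
   `F₃ = (1-x)ⁿ(1-w)ⁿpₙ(y)/(1-(1-xy)w)`;
4. `n` integrations by parts in `y` turn `F₃` into the integrand of `tripleIntegral n`.

The three-dimensional bookkeeping is Fubini over one coordinate of the open cube
(`integral_cube_eq_integral_square_integral`, from `MeasureTheory.measurePreserving_piFinSuccAbove`)
and absolute integrability of `F₁, …, F₄`, all dominated by a constant times `1/(1-(1-xy)z)`,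
itself at most `x^{-1/2} y^{-1/2} (1-z)^{-1/2}` (`one_div_den_le`).

## References
* [AndrewsAskeyRoy1999] G. E. Andrews, R. Askey, R. Roy, Special Functions, CUP (1999), §7.7,
  Lemma 7.7.4 and display (7.7.3), p. 392.
* [Beukers1979] F. Beukers, A note on the irrationality of `ζ(2)` and `ζ(3)`, Bull. London Math.
  Soc. 11 (1979) 268–272.
-/

noncomputable section

open MeasureTheory Set Polynomial intervalIntegral

open scoped Nat

namespace Literature.NumberTheory.Transcendental

namespace Beukers

/-! ### The open unit cube as a product and Fubini over one coordinate -/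

/-- The open unit cube `{p | ∀ i, p i ∈ (0,1)}` of `Fin k → ℝ` is the product set
`Set.pi univ (fun _ => Ioo 0 1)`. [folklore] -/
theorem setOf_forall_mem_Ioo_eq_pi (k : ℕ) :
    {p : Fin k → ℝ | ∀ i, p i ∈ Ioo (0 : ℝ) 1} = Set.pi univ fun _ => Ioo (0 : ℝ) 1 := by
  ext p
  simp

/-- The open unit cube of `Fin k → ℝ` is measurable. [folklore] -/
theorem measurableSet_cube (k : ℕ) :
    MeasurableSet {p : Fin k → ℝ | ∀ i, p i ∈ Ioo (0 : ℝ) 1} := by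
  rw [setOf_forall_mem_Ioo_eq_pi]
  exact MeasurableSet.univ_pi fun _ => measurableSet_Ioo

/-- Lebesgue measure restricted to the open unit cube of `Fin k → ℝ` is the product of `k` copies
of Lebesgue measure restricted to `(0,1)`. [folklore] -/
theorem volume_restrict_cube (k : ℕ) :
    (volume : Measure (Fin k → ℝ)).restrict {p | ∀ i, p i ∈ Ioo (0 : ℝ) 1} =
      Measure.pi fun _ : Fin k => (volume : Measure ℝ).restrict (Ioo 0 1) := by
  rw [setOf_forall_mem_Ioo_eq_pi, volume_pi, Measure.restrict_pi_pi]

/-- **Fubini over one coordinate of the open unit cube.** For `F` integrable on the open unit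
cube of `ℝ³` and a coordinate `i`, the integral of `F` is the integral over the open unit square
of the inner integrals over the `i`-th coordinate. [folklore] -/
theorem integral_cube_eq_integral_square_integral (i : Fin 3) (F : (Fin 3 → ℝ) → ℝ)
    (hF : IntegrableOn F {p : Fin 3 → ℝ | ∀ j, p j ∈ Ioo (0 : ℝ) 1}) :
    ∫ p in {p : Fin 3 → ℝ | ∀ j, p j ∈ Ioo (0 : ℝ) 1}, F p =
      ∫ q in {q : Fin 2 → ℝ | ∀ j, q j ∈ Ioo (0 : ℝ) 1},
        ∫ t in Ioo (0 : ℝ) 1, F (i.insertNth t q) := by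
  rw [IntegrableOn, volume_restrict_cube] at hF
  rw [volume_restrict_cube, volume_restrict_cube]
  have hmp := (measurePreserving_piFinSuccAbove
    (fun _ : Fin 3 => (volume : Measure ℝ).restrict (Ioo 0 1)) i).symm
  rw [← hmp.integrable_comp_emb (MeasurableEquiv.measurableEmbedding _)] at hF
  rw [← hmp.integral_comp']
  exact integral_prod_symm _ hF

/-- Two integrable functions on the open unit cube of `ℝ³` whose inner integrals over the `i`-th
coordinate agree at every point of the open unit square have the same integral. [folklore] -/
theorem integral_cube_congr_slice (i : Fin 3) {F G : (Fin 3 → ℝ) → ℝ}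
    (hF : IntegrableOn F {p : Fin 3 → ℝ | ∀ j, p j ∈ Ioo (0 : ℝ) 1})
    (hG : IntegrableOn G {p : Fin 3 → ℝ | ∀ j, p j ∈ Ioo (0 : ℝ) 1})
    (h : ∀ q : Fin 2 → ℝ, (∀ j, q j ∈ Ioo (0 : ℝ) 1) →
      ∫ t in (0 : ℝ)..1, F (i.insertNth t q) = ∫ t in (0 : ℝ)..1, G (i.insertNth t q)) :
    ∫ p in {p : Fin 3 → ℝ | ∀ j, p j ∈ Ioo (0 : ℝ) 1}, F p =
      ∫ p in {p : Fin 3 → ℝ | ∀ j, p j ∈ Ioo (0 : ℝ) 1}, G p := by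
  rw [integral_cube_eq_integral_square_integral i F hF,
    integral_cube_eq_integral_square_integral i G hG]
  refine setIntegral_congr_fun (measurableSet_cube 2) fun q hq => ?_
  have := h q hq
  rwa [intervalIntegral.integral_of_le zero_le_one, intervalIntegral.integral_of_le zero_le_one,
    integral_Ioc_eq_integral_Ioo, integral_Ioc_eq_integral_Ioo] at this

/-- `Fin.insertNth 0 t q = ![t, q 0, q 1]`. [folklore] -/
theorem insertNth_zero_eq (t : ℝ) (q : Fin 2 → ℝ) :
    (Fin.insertNth (0 : Fin 3) t q : Fin 3 → ℝ) = ![t, q 0, q 1] := by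
  ext j
  fin_cases j <;> rfl

/-- `Fin.insertNth 1 t q = ![q 0, t, q 1]`. [folklore] -/
theorem insertNth_one_eq (t : ℝ) (q : Fin 2 → ℝ) :
    (Fin.insertNth (1 : Fin 3) t q : Fin 3 → ℝ) = ![q 0, t, q 1] := by
  ext j
  fin_cases j <;> rfl

/-- `Fin.insertNth 2 t q = ![q 0, q 1, t]`. [folklore] -/
theorem insertNth_two_eq (t : ℝ) (q : Fin 2 → ℝ) :
    (Fin.insertNth (2 : Fin 3) t q : Fin 3 → ℝ) = ![q 0, q 1, t] := by
  ext j
  fin_cases j <;> rfl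

/-! ### The denominator `1 - (1-xy)z` and absolute integrability on the cube -/

/-- On the open unit cube, `xy ≤ 1 - (1-xy)z`. [folklore] -/
theorem mul_le_den {x y z : ℝ} (hx : x ∈ Ioo (0 : ℝ) 1) (hy : y ∈ Ioo (0 : ℝ) 1)
    (hz : z ∈ Ioo (0 : ℝ) 1) : x * y ≤ 1 - (1 - x * y) * z := by
  nlinarith [hx.1, hx.2, hy.1, hy.2, hz.1, hz.2, mul_pos hx.1 hy.1,
    mul_lt_mul'' hx.2 hy.2 hx.1.le hy.1.le]

/-- On the open unit cube, `1 - z ≤ 1 - (1-xy)z`. [folklore] -/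
theorem one_sub_le_den {x y z : ℝ} (hx : x ∈ Ioo (0 : ℝ) 1) (hy : y ∈ Ioo (0 : ℝ) 1)
    (hz : z ∈ Ioo (0 : ℝ) 1) : 1 - z ≤ 1 - (1 - x * y) * z := by
  nlinarith [hz.1, mul_pos hx.1 hy.1]

/-- On the open unit cube, `0 < 1 - (1-xy)z`. [folklore] -/
theorem den_pos {x y z : ℝ} (hx : x ∈ Ioo (0 : ℝ) 1) (hy : y ∈ Ioo (0 : ℝ) 1)
    (hz : z ∈ Ioo (0 : ℝ) 1) : 0 < 1 - (1 - x * y) * z :=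
  lt_of_lt_of_le (mul_pos hx.1 hy.1) (mul_le_den hx hy hz)

/-- The domination `1/(1-(1-xy)z) ≤ x^{-1/2} y^{-1/2} (1-z)^{-1/2}` on the open unit cube
(from `1-(1-xy)z ≥ xy` and `≥ 1-z`). [folklore] -/
theorem one_div_den_le {x y z : ℝ} (hx : x ∈ Ioo (0 : ℝ) 1) (hy : y ∈ Ioo (0 : ℝ) 1)
    (hz : z ∈ Ioo (0 : ℝ) 1) :
    1 / (1 - (1 - x * y) * z) ≤
      x ^ (-(1 / 2 : ℝ)) * y ^ (-(1 / 2 : ℝ)) * (1 - z) ^ (-(1 / 2 : ℝ)) := by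
  have hxy : 0 < x * y := mul_pos hx.1 hy.1
  have h1z : 0 < 1 - z := by linarith [hz.2]
  have hDxy := mul_le_den hx hy hz
  have hD1z := one_sub_le_den hx hy hz
  have hDpos := den_pos hx hy hz
  have hrpow : ∀ t : ℝ, 0 < t → t ^ (-(1 / 2 : ℝ)) = 1 / Real.sqrt t := by
    intro t ht
    rw [Real.rpow_neg ht.le, Real.sqrt_eq_rpow]
    exact (one_div _).symm
  rw [hrpow x hx.1, hrpow y hy.1, hrpow (1 - z) h1z, one_div_mul_one_div, one_div_mul_one_div,
    ← Real.sqrt_mul hx.1.le, ← Real.sqrt_mul hxy.le]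
  apply one_div_le_one_div_of_le (Real.sqrt_pos.2 (by positivity))
  calc Real.sqrt (x * y * (1 - z)) ≤ Real.sqrt ((1 - (1 - x * y) * z) * (1 - (1 - x * y) * z)) :=
        Real.sqrt_le_sqrt (mul_le_mul hDxy hD1z h1z.le hDpos.le)
    _ = 1 - (1 - x * y) * z := Real.sqrt_mul_self hDpos.le

/-- The dominating product `x^{-1/2} y^{-1/2} (1-z)^{-1/2}` is integrable on the open unit cube
(a product of one-variable integrable functions, `MeasureTheory.Integrable.fintype_prod`).
[folklore] -/
theorem integrableOn_rpow_prod_cube :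
    IntegrableOn (fun p : Fin 3 → ℝ =>
      p 0 ^ (-(1 / 2 : ℝ)) * p 1 ^ (-(1 / 2 : ℝ)) * (1 - p 2) ^ (-(1 / 2 : ℝ)))
      {p : Fin 3 → ℝ | ∀ j, p j ∈ Ioo (0 : ℝ) 1} := by
  have h0 : IntegrableOn (fun x : ℝ => x ^ (-(1 / 2 : ℝ))) (Ioo 0 1) := by
    have := intervalIntegral.intervalIntegrable_rpow' (a := 0) (b := 1) (r := -(1 / 2 : ℝ))
      (by norm_num)
    exact ((intervalIntegrable_iff_integrableOn_Ioc_of_le zero_le_one).mp this).mono_set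
      Ioo_subset_Ioc_self
  have h1 : IntegrableOn (fun x : ℝ => (1 - x) ^ (-(1 / 2 : ℝ))) (Ioo 0 1) := by
    have := (intervalIntegral.intervalIntegrable_rpow' (a := 1) (b := 0) (r := -(1 / 2 : ℝ))
      (by norm_num)).comp_sub_left 1
    norm_num at this
    exact ((intervalIntegrable_iff_integrableOn_Ioc_of_le zero_le_one).mp this).mono_set
      Ioo_subset_Ioc_self
  rw [IntegrableOn, volume_restrict_cube]
  let g : Fin 3 → ℝ → ℝ :=
    ![fun x => x ^ (-(1 / 2 : ℝ)), fun x => x ^ (-(1 / 2 : ℝ)), fun x => (1 - x) ^ (-(1 / 2 : ℝ))]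
  have hg : ∀ i, Integrable (g i) ((volume : Measure ℝ).restrict (Ioo 0 1)) := by
    intro i
    fin_cases i
    · exact h0
    · exact h0
    · exact h1
  have hprod := Integrable.fintype_prod (f := g)
    (μ := fun _ : Fin 3 => (volume : Measure ℝ).restrict (Ioo 0 1)) hg
  have hfun : (fun p : Fin 3 → ℝ =>
      p 0 ^ (-(1 / 2 : ℝ)) * p 1 ^ (-(1 / 2 : ℝ)) * (1 - p 2) ^ (-(1 / 2 : ℝ))) =
      fun p => ∏ i, g i (p i) := by
    funext p
    simp [Fin.prod_univ_three, g, mul_assoc]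
  rw [hfun]
  exact hprod

/-- A function continuous on the open unit cube and dominated there by a constant times
`1/(1-(1-xy)z)` is integrable on the cube. [folklore] -/
theorem integrableOn_cube_of_le {F : (Fin 3 → ℝ) → ℝ} {C : ℝ} (hC : 0 ≤ C)
    (hFc : ContinuousOn F {p : Fin 3 → ℝ | ∀ j, p j ∈ Ioo (0 : ℝ) 1})
    (hle : ∀ p : Fin 3 → ℝ, (∀ j, p j ∈ Ioo (0 : ℝ) 1) →
      |F p| ≤ C / (1 - (1 - p 0 * p 1) * p 2)) :
    IntegrableOn F {p : Fin 3 → ℝ | ∀ j, p j ∈ Ioo (0 : ℝ) 1} := by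
  have hB := integrableOn_rpow_prod_cube.const_mul C
  refine Integrable.mono' hB (hFc.aestronglyMeasurable (measurableSet_cube 3)) ?_
  refine (ae_restrict_iff' (measurableSet_cube 3)).2 (ae_of_all _ fun p hp => ?_)
  rw [Real.norm_eq_abs]
  calc |F p| ≤ C / (1 - (1 - p 0 * p 1) * p 2) := hle p hp
    _ = C * (1 / (1 - (1 - p 0 * p 1) * p 2)) := by rw [mul_one_div]
    _ ≤ C * (p 0 ^ (-(1 / 2 : ℝ)) * p 1 ^ (-(1 / 2 : ℝ)) * (1 - p 2) ^ (-(1 / 2 : ℝ))) :=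
        mul_le_mul_of_nonneg_left (one_div_den_le (hp 0) (hp 1) (hp 2)) hC

/-- If `0 ≤ N ≤ B Dⁿ` and `D > 0` then `N / Dⁿ⁺¹ ≤ B / D`. [folklore] -/
theorem div_pow_succ_le_div {N D B : ℝ} (n : ℕ) (hD : 0 < D) (h : N ≤ B * D ^ n) :
    N / D ^ (n + 1) ≤ B / D := by
  rw [div_le_div_iff₀ (pow_pos hD _) hD, pow_succ]
  calc N * D ≤ B * D ^ n * D := mul_le_mul_of_nonneg_right h hD.le
    _ = B * (D ^ n * D) := by ring

/-- A uniform bound for `|pₙ|` on `[0,1]`. [folklore] -/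
theorem exists_bound_shiftedLegendre (n : ℕ) :
    ∃ M : ℝ, 0 ≤ M ∧ ∀ x ∈ Icc (0 : ℝ) 1, |aeval x (shiftedLegendre n)| ≤ M := by
  obtain ⟨M, hM⟩ := isCompact_Icc.exists_bound_of_continuousOn
    ((shiftedLegendre n).continuousOn_aeval (s := Icc (0 : ℝ) 1))
  refine ⟨M, ?_, fun x hx => ?_⟩
  · exact (norm_nonneg _).trans (hM 0 ⟨le_rfl, zero_le_one⟩)
  · rw [← Real.norm_eq_abs]
    exact hM x hx

/-! ### One-variable steps -/

/-- The kernel identity `∫₀¹ dz/(1-az) = -log(1-a)/a` for `0 < a < 1`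
(AAR p. 392: `-log(xy)/(1-xy) = ∫₀¹ dz/(1-(1-xy)z)`).
[cite: AndrewsAskeyRoy1999, Lemma 7.7.4 (proof)] -/
theorem integral_one_div_one_sub_mul {a : ℝ} (ha0 : 0 < a) (ha1 : a < 1) :
    ∫ z in (0 : ℝ)..1, 1 / (1 - a * z) = -Real.log (1 - a) / a := by
  have hden : ∀ z ∈ uIcc (0 : ℝ) 1, 1 - a * z ≠ 0 := by
    intro z hz
    rw [uIcc_of_le zero_le_one] at hz
    have : a * z ≤ a * 1 := by nlinarith [hz.1, hz.2]
    intro h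
    nlinarith
  have hderiv : ∀ z ∈ uIcc (0 : ℝ) 1,
      HasDerivAt (fun z => -Real.log (1 - a * z) / a) (1 / (1 - a * z)) z := by
    intro z hz
    have h1 : HasDerivAt (fun z => 1 - a * z) (-a) z := by
      simpa using ((hasDerivAt_id z).const_mul a).const_sub 1
    have h2 : HasDerivAt (fun z => -Real.log (1 - a * z) / a) (-(-a / (1 - a * z)) / a) z :=
      ((h1.log (hden z hz)).neg).div_const a
    convert h2 using 1
    field_simp
  have hcont : ContinuousOn (fun z : ℝ => 1 / (1 - a * z)) (uIcc 0 1) :=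
    continuousOn_const.div (Continuous.continuousOn (by fun_prop)) hden
  rw [integral_eq_sub_of_hasDerivAt hderiv (hcont.intervalIntegrable)]
  simp

/-- **`m`-fold integration by parts on `[0,1]`** for families `u k`, `v k` of successive
derivatives, when `u k` vanishes at both endpoints for `k < m`:
`∫₀¹ u⁽ᵐ⁾ v = (-1)ᵐ ∫₀¹ u v⁽ᵐ⁾`. [folklore] -/
theorem integral_deriv_iterate_mul_eq (m : ℕ) :
    ∀ (u v : ℕ → ℝ → ℝ),
      (∀ k, ∀ x ∈ uIcc (0 : ℝ) 1, HasDerivAt (u k) (u (k + 1) x) x) →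
      (∀ k, ∀ x ∈ uIcc (0 : ℝ) 1, HasDerivAt (v k) (v (k + 1) x) x) →
      (∀ k < m, u k 0 = 0) → (∀ k < m, u k 1 = 0) →
      ∫ x in (0 : ℝ)..1, u m x * v 0 x = (-1) ^ m * ∫ x in (0 : ℝ)..1, u 0 x * v m x := by
  induction m with
  | zero =>
    intro u v _ _ _ _
    simp
  | succ m ih =>
    intro u v hu hv h0 h1
    have hcu : ∀ k, ContinuousOn (u k) (uIcc 0 1) := fun k =>
      HasDerivAt.continuousOn (hu k)
    have hcv : ∀ k, ContinuousOn (v k) (uIcc 0 1) := fun k =>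
      HasDerivAt.continuousOn (hv k)
    have step : ∫ x in (0 : ℝ)..1, u (m + 1) x * v 0 x =
        -∫ x in (0 : ℝ)..1, u m x * v 1 x := by
      have hibp := integral_mul_deriv_eq_deriv_mul (hv 0) (hu m)
        ((hcv 1).intervalIntegrable) ((hcu (m + 1)).intervalIntegrable)
      rw [h0 m (Nat.lt_succ_self m), h1 m (Nat.lt_succ_self m)] at hibp
      simp only [mul_zero, sub_zero, zero_sub] at hibp
      simp_rw [mul_comm (u (m + 1) _), mul_comm (u m _)]
      exact hibp
    rw [step, ih u (fun k => v (k + 1)) hu (fun k => hv (k + 1))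
      (fun k hk => h0 k (Nat.lt_succ_of_lt hk)) (fun k hk => h1 k (Nat.lt_succ_of_lt hk))]
    ring

/-- Rodrigues' formula for `pₙ` over `ℝ`: `pₙ(x) = (1/n!) (dⁿ/dxⁿ)(xⁿ(1-x)ⁿ)(x)`
(`Polynomial.factorial_mul_shiftedLegendre_eq`). [folklore] -/
theorem aeval_shiftedLegendre_eq (n : ℕ) (x : ℝ) :
    aeval x (shiftedLegendre n) =
      (1 / n ! : ℝ) * (derivative^[n] ((X : ℝ[X]) ^ n * (1 - X) ^ n)).eval x := by
  have h := congrArg (Polynomial.map (algebraMap ℤ ℝ)) (factorial_mul_shiftedLegendre_eq n)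
  rw [← iterate_derivative_map] at h
  simp only [Polynomial.map_mul, Polynomial.map_pow, Polynomial.map_sub, Polynomial.map_one,
    map_X, Polynomial.map_natCast] at h
  have h2 := congrArg (eval x) h
  rw [eval_mul, eval_natCast] at h2
  rw [aeval_def, ← eval_map, ← h2]
  field_simp

/-- The iterated derivatives of `xⁿ(1-x)ⁿ` of order `k < n` vanish at `0` and at `1`.
[folklore] -/
theorem eval_iterate_derivative_eq_zero (n k : ℕ) (hk : k < n) :
    (derivative^[k] ((X : ℝ[X]) ^ n * (1 - X) ^ n)).eval 0 = 0 ∧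
      (derivative^[k] ((X : ℝ[X]) ^ n * (1 - X) ^ n)).eval 1 = 0 := by
  have hk' : n - k ≠ 0 := Nat.sub_ne_zero_of_lt hk
  constructor
  · have hd : (X - C (0 : ℝ)) ^ n ∣ (X : ℝ[X]) ^ n * (1 - X) ^ n := by
      simp
    have := (dvd_pow_self _ hk').trans (pow_sub_dvd_iterate_derivative_of_pow_dvd k hd)
    exact dvd_iff_isRoot.mp this
  · have hd : (X - C (1 : ℝ)) ^ n ∣ (X : ℝ[X]) ^ n * (1 - X) ^ n := by
      have h1 : (1 - X : ℝ[X]) ^ n = (-1) ^ n * (X - C 1) ^ n := by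
        rw [← mul_pow]
        congr 1
        simp
      rw [h1]
      exact dvd_mul_of_dvd_right (dvd_mul_left _ _) _
    have := (dvd_pow_self _ hk').trans (pow_sub_dvd_iterate_derivative_of_pow_dvd k hd)
    exact dvd_iff_isRoot.mp this

/-- **`n`-fold integration by parts against `pₙ`**: for a family `v k` of successive
derivatives on `[0,1]`, `∫₀¹ pₙ v₀ = ((-1)ⁿ/n!) ∫₀¹ xⁿ(1-x)ⁿ vₙ`.
[cite: AndrewsAskeyRoy1999, Lemma 7.7.4 (proof)] -/
theorem integral_shiftedLegendre_mul (n : ℕ) (v : ℕ → ℝ → ℝ)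
    (hv : ∀ k, ∀ x ∈ uIcc (0 : ℝ) 1, HasDerivAt (v k) (v (k + 1) x) x) :
    ∫ x in (0 : ℝ)..1, aeval x (shiftedLegendre n) * v 0 x =
      (-1) ^ n / n ! * ∫ x in (0 : ℝ)..1, x ^ n * (1 - x) ^ n * v n x := by
  have hu : ∀ k, ∀ x ∈ uIcc (0 : ℝ) 1,
      HasDerivAt (fun x => (derivative^[k] ((X : ℝ[X]) ^ n * (1 - X) ^ n)).eval x)
        ((derivative^[k + 1] ((X : ℝ[X]) ^ n * (1 - X) ^ n)).eval x) x := by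
    intro k x _
    rw [Function.iterate_succ_apply']
    exact Polynomial.hasDerivAt _ x
  have main := integral_deriv_iterate_mul_eq n
    (fun k x => (derivative^[k] ((X : ℝ[X]) ^ n * (1 - X) ^ n)).eval x) v hu hv
    (fun k hk => (eval_iterate_derivative_eq_zero n k hk).1)
    (fun k hk => (eval_iterate_derivative_eq_zero n k hk).2)
  simp only [Function.iterate_zero, id_eq, eval_mul, eval_pow, eval_X, eval_sub, eval_one]
    at main
  simp_rw [aeval_shiftedLegendre_eq n, mul_assoc]
  rw [intervalIntegral.integral_const_mul, main]
  ring

/-- Successive derivatives of `1/(c+bx)`: `d/dx [(-1)ᵏ k! bᵏ/(c+bx)ᵏ⁺¹] =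
(-1)ᵏ⁺¹ (k+1)! bᵏ⁺¹/(c+bx)ᵏ⁺²` where `c + bx ≠ 0`. [folklore] -/
theorem hasDerivAt_inv_linear_family (c b : ℝ) (k : ℕ) {x : ℝ} (hx : c + b * x ≠ 0) :
    HasDerivAt (fun x => (-1) ^ k * k ! * b ^ k / (c + b * x) ^ (k + 1))
      ((-1) ^ (k + 1) * (k + 1)! * b ^ (k + 1) / (c + b * x) ^ (k + 2)) x := by
  have h1 : HasDerivAt (fun x => c + b * x) b x := by
    simpa using ((hasDerivAt_id x).const_mul b).const_add c
  have h2 := (hasDerivAt_const x ((-1) ^ k * (k ! : ℝ) * b ^ k)).fun_div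
    (h1.fun_pow (k + 1)) (pow_ne_zero _ hx)
  refine h2.congr_deriv ?_
  simp only [Nat.add_sub_cancel, Nat.factorial_succ]
  push_cast
  field_simp
  ring

/-- **`n` integrations by parts against `pₙ` for the kernel `1/(c+bx)`** (`c > 0`, `b ≥ 0`):
`∫₀¹ pₙ(x)/(c+bx) dx = ∫₀¹ xⁿ(1-x)ⁿ bⁿ/(c+bx)ⁿ⁺¹ dx`.
[cite: AndrewsAskeyRoy1999, Lemma 7.7.4 (proof)] -/
theorem integral_shiftedLegendre_div_linear (n : ℕ) {c b : ℝ} (hc : 0 < c) (hb : 0 ≤ b) :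
    ∫ x in (0 : ℝ)..1, aeval x (shiftedLegendre n) / (c + b * x) =
      ∫ x in (0 : ℝ)..1, x ^ n * (1 - x) ^ n * b ^ n / (c + b * x) ^ (n + 1) := by
  have hpos : ∀ x ∈ uIcc (0 : ℝ) 1, 0 < c + b * x := by
    intro x hx
    rw [uIcc_of_le zero_le_one] at hx
    have := mul_nonneg hb hx.1
    linarith
  have key := integral_shiftedLegendre_mul n
    (fun k x => (-1) ^ k * k ! * b ^ k / (c + b * x) ^ (k + 1))
    (fun k x hx => hasDerivAt_inv_linear_family c b k (hpos x hx).ne')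
  have hl : ∫ x in (0 : ℝ)..1, aeval x (shiftedLegendre n) / (c + b * x) =
      ∫ x in (0 : ℝ)..1, aeval x (shiftedLegendre n) *
        ((-1) ^ 0 * (0 : ℕ)! * b ^ 0 / (c + b * x) ^ (0 + 1)) :=
    intervalIntegral.integral_congr fun x _ => by simp [div_eq_mul_inv]
  have hsq : ((-1 : ℝ) ^ n) * (-1) ^ n = 1 := by
    rw [← mul_pow]
    norm_num
  have hn : (n ! : ℝ) ≠ 0 := by positivity
  have hr : (-1) ^ n / n ! * ∫ x in (0 : ℝ)..1, x ^ n * (1 - x) ^ n *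
        ((-1) ^ n * n ! * b ^ n / (c + b * x) ^ (n + 1)) =
      ∫ x in (0 : ℝ)..1, x ^ n * (1 - x) ^ n * b ^ n / (c + b * x) ^ (n + 1) := by
    rw [← intervalIntegral.integral_const_mul]
    refine intervalIntegral.integral_congr fun x _ => ?_
    calc (-1 : ℝ) ^ n / n ! * (x ^ n * (1 - x) ^ n *
          ((-1) ^ n * n ! * b ^ n / (c + b * x) ^ (n + 1)))
        = ((-1) ^ n * (-1) ^ n) * ((n ! : ℝ) / n !) *
            (x ^ n * (1 - x) ^ n * b ^ n / (c + b * x) ^ (n + 1)) := by ring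
      _ = x ^ n * (1 - x) ^ n * b ^ n / (c + b * x) ^ (n + 1) := by
          rw [hsq, div_self hn]
          ring
  rw [hl, key, hr]

/-- **Beukers' substitution** `w = (1-z)/(1-(1-a)z)` (`0 < a < 1`, `a = xy` in the proof):
`∫₀¹ aⁿzⁿ/(1-(1-a)z)ⁿ⁺¹ dz = ∫₀¹ (1-w)ⁿ/(1-(1-a)w) dw`
(`1 - w = az/(1-(1-a)z)`, `1-(1-a)w = a/(1-(1-a)z)`, `dw = -a dz/(1-(1-a)z)²`).
[cite: AndrewsAskeyRoy1999, Lemma 7.7.4 (proof)] -/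
theorem integral_substitution_beukers (n : ℕ) {a : ℝ} (ha0 : 0 < a) (ha1 : a < 1) :
    ∫ z in (0 : ℝ)..1, a ^ n * z ^ n / (1 - (1 - a) * z) ^ (n + 1) =
      ∫ w in (0 : ℝ)..1, (1 - w) ^ n / (1 - (1 - a) * w) := by
  have hD : ∀ z ∈ uIcc (0 : ℝ) 1, 0 < 1 - (1 - a) * z := by
    intro z hz
    rw [uIcc_of_le zero_le_one] at hz
    nlinarith [hz.1, hz.2]
  have hφ : ∀ z ∈ uIcc (0 : ℝ) 1,
      HasDerivAt (fun z => (1 - z) / (1 - (1 - a) * z))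
        (-a / (1 - (1 - a) * z) ^ 2) z := by
    intro z hz
    have hnum : HasDerivAt (fun z : ℝ => 1 - z) (-1) z := by
      simpa using (hasDerivAt_id z).const_sub 1
    have hden : HasDerivAt (fun z => 1 - (1 - a) * z) (-(1 - a)) z := by
      simpa using ((hasDerivAt_id z).const_mul (1 - a)).const_sub 1
    exact (hnum.fun_div hden (hD z hz).ne').congr_deriv (by ring)
  have hφ' : ContinuousOn (fun z => -a / (1 - (1 - a) * z) ^ 2) (uIcc 0 1) :=
    continuousOn_const.div (Continuous.continuousOn (by fun_prop))
      fun z hz => pow_ne_zero _ (hD z hz).ne'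
  have himg : ∀ z ∈ uIcc (0 : ℝ) 1,
      1 - (1 - a) * ((1 - z) / (1 - (1 - a) * z)) = a / (1 - (1 - a) * z) := by
    intro z hz
    rw [mul_div_assoc', sub_div' (hD z hz).ne']
    congr 1
    ring
  have himg' : ∀ z ∈ uIcc (0 : ℝ) 1,
      1 - (1 - z) / (1 - (1 - a) * z) = a * z / (1 - (1 - a) * z) := by
    intro z hz
    rw [one_sub_div (hD z hz).ne']
    congr 1
    ring
  have hg : ContinuousOn (fun w => (1 - w) ^ n / (1 - (1 - a) * w))
      ((fun z => (1 - z) / (1 - (1 - a) * z)) '' uIcc 0 1) := by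
    rintro _ ⟨z, hz, rfl⟩
    apply ContinuousAt.continuousWithinAt
    refine ContinuousAt.div (by fun_prop) (by fun_prop) ?_
    rw [himg z hz]
    exact (div_pos ha0 (hD z hz)).ne'
  have key := integral_comp_mul_deriv' hφ hφ' hg
  simp only [Function.comp, sub_self, zero_div, sub_zero, mul_zero, div_one, mul_one] at key
  rw [integral_symm (0 : ℝ) 1] at key
  have hpt : EqOn
      (fun z => (1 - (1 - z) / (1 - (1 - a) * z)) ^ n /
        (1 - (1 - a) * ((1 - z) / (1 - (1 - a) * z))) * (-a / (1 - (1 - a) * z) ^ 2))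
      (fun z => -(a ^ n * z ^ n / (1 - (1 - a) * z) ^ (n + 1))) (uIcc 0 1) := by
    intro z hz
    simp only
    rw [himg z hz, himg' z hz]
    set D := 1 - (1 - a) * z with hDdef
    have hD0 : D ≠ 0 := (hD z hz).ne'
    have ha : a ≠ 0 := ha0.ne'
    rw [div_pow, mul_pow, div_div_eq_mul_div]
    field_simp
    ring
  rw [intervalIntegral.integral_congr hpt, intervalIntegral.integral_neg, neg_inj] at key
  exact key

/-! ### The four integrands and their integrability -/

/-- `F₁ = pₙ(x)pₙ(y)/(1-(1-xy)z)` is integrable on the open unit cube.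
[cite: AndrewsAskeyRoy1999, Lemma 7.7.4 (proof)] -/
theorem integrableOn_F₁ (n : ℕ) :
    IntegrableOn (fun p : Fin 3 → ℝ =>
      aeval (p 0) (shiftedLegendre n) * aeval (p 1) (shiftedLegendre n) /
        (1 - (1 - p 0 * p 1) * p 2)) {p : Fin 3 → ℝ | ∀ j, p j ∈ Ioo (0 : ℝ) 1} := by
  obtain ⟨M, hM0, hM⟩ := exists_bound_shiftedLegendre n
  refine integrableOn_cube_of_le (C := M * M) (mul_nonneg hM0 hM0) ?_ ?_
  · exact ContinuousOn.div (Continuous.continuousOn (by fun_prop))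
      (Continuous.continuousOn (by fun_prop)) fun p hp => (den_pos (hp 0) (hp 1) (hp 2)).ne'
  · intro p hp
    have hD := den_pos (hp 0) (hp 1) (hp 2)
    rw [abs_div, abs_of_pos hD, abs_mul]
    exact div_le_div_of_nonneg_right (mul_le_mul (hM _ (Ioo_subset_Icc_self (hp 0)))
      (hM _ (Ioo_subset_Icc_self (hp 1))) (abs_nonneg _) hM0) hD.le

/-- `F₂ = (xyz)ⁿ(1-x)ⁿpₙ(y)/(1-(1-xy)z)ⁿ⁺¹` is integrable on the open unit cube.
[cite: AndrewsAskeyRoy1999, Lemma 7.7.4 (proof)] -/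
theorem integrableOn_F₂ (n : ℕ) :
    IntegrableOn (fun p : Fin 3 → ℝ =>
      (p 0 * p 1 * p 2) ^ n * (1 - p 0) ^ n * aeval (p 1) (shiftedLegendre n) /
        (1 - (1 - p 0 * p 1) * p 2) ^ (n + 1)) {p : Fin 3 → ℝ | ∀ j, p j ∈ Ioo (0 : ℝ) 1} := by
  obtain ⟨M, hM0, hM⟩ := exists_bound_shiftedLegendre n
  refine integrableOn_cube_of_le (C := M) hM0 ?_ ?_
  · exact ContinuousOn.div (Continuous.continuousOn (by fun_prop))
      (Continuous.continuousOn (by fun_prop))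
      fun p hp => pow_ne_zero _ (den_pos (hp 0) (hp 1) (hp 2)).ne'
  · intro p hp
    have hD := den_pos (hp 0) (hp 1) (hp 2)
    have hxyz : 0 ≤ p 0 * p 1 * p 2 := by
      have := (hp 0).1; have := (hp 1).1; have := (hp 2).1
      positivity
    have hxyzD : p 0 * p 1 * p 2 ≤ 1 - (1 - p 0 * p 1) * p 2 := by
      nlinarith [mul_le_den (hp 0) (hp 1) (hp 2), (hp 2).2, mul_pos (hp 0).1 (hp 1).1]
    have h1x : 0 ≤ 1 - p 0 := by linarith [(hp 0).2]
    have h1x' : 1 - p 0 ≤ 1 := by linarith [(hp 0).1]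
    rw [abs_div, abs_of_pos (pow_pos hD _), abs_mul, abs_mul, abs_of_nonneg (pow_nonneg hxyz _),
      abs_of_nonneg (pow_nonneg h1x _)]
    refine div_pow_succ_le_div n hD ?_
    calc (p 0 * p 1 * p 2) ^ n * (1 - p 0) ^ n * |aeval (p 1) (shiftedLegendre n)|
        ≤ (1 - (1 - p 0 * p 1) * p 2) ^ n * 1 * M :=
          mul_le_mul (mul_le_mul (pow_le_pow_left₀ hxyz hxyzD n) (pow_le_one₀ h1x h1x')
            (pow_nonneg h1x _) (pow_nonneg hD.le _)) (hM _ (Ioo_subset_Icc_self (hp 1)))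
            (abs_nonneg _) (by positivity)
      _ = M * (1 - (1 - p 0 * p 1) * p 2) ^ n := by ring

/-- `F₃ = (1-x)ⁿ(1-w)ⁿpₙ(y)/(1-(1-xy)w)` is integrable on the open unit cube.
[cite: AndrewsAskeyRoy1999, Lemma 7.7.4 (proof)] -/
theorem integrableOn_F₃ (n : ℕ) :
    IntegrableOn (fun p : Fin 3 → ℝ =>
      (1 - p 0) ^ n * (1 - p 2) ^ n * aeval (p 1) (shiftedLegendre n) /
        (1 - (1 - p 0 * p 1) * p 2)) {p : Fin 3 → ℝ | ∀ j, p j ∈ Ioo (0 : ℝ) 1} := by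
  obtain ⟨M, hM0, hM⟩ := exists_bound_shiftedLegendre n
  refine integrableOn_cube_of_le (C := M) hM0 ?_ ?_
  · exact ContinuousOn.div (Continuous.continuousOn (by fun_prop))
      (Continuous.continuousOn (by fun_prop)) fun p hp => (den_pos (hp 0) (hp 1) (hp 2)).ne'
  · intro p hp
    have hD := den_pos (hp 0) (hp 1) (hp 2)
    have h1x : 0 ≤ 1 - p 0 := by linarith [(hp 0).2]
    have h1x' : 1 - p 0 ≤ 1 := by linarith [(hp 0).1]
    have h1z : 0 ≤ 1 - p 2 := by linarith [(hp 2).2]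
    have h1z' : 1 - p 2 ≤ 1 := by linarith [(hp 2).1]
    rw [abs_div, abs_of_pos hD, abs_mul, abs_mul, abs_of_nonneg (pow_nonneg h1x _),
      abs_of_nonneg (pow_nonneg h1z _)]
    refine div_le_div_of_nonneg_right ?_ hD.le
    calc (1 - p 0) ^ n * (1 - p 2) ^ n * |aeval (p 1) (shiftedLegendre n)|
        ≤ 1 * 1 * M :=
          mul_le_mul (mul_le_mul (pow_le_one₀ h1x h1x') (pow_le_one₀ h1z h1z')
            (pow_nonneg h1z _) zero_le_one) (hM _ (Ioo_subset_Icc_self (hp 1)))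
            (abs_nonneg _) (by positivity)
      _ = M := by ring

/-- `F₄ = (x(1-x)y(1-y)w(1-w))ⁿ/(1-(1-xy)w)ⁿ⁺¹`, the integrand of `tripleIntegral n`, is
integrable on the open unit cube. [cite: AndrewsAskeyRoy1999, (7.7.3)] -/
theorem integrableOn_F₄ (n : ℕ) :
    IntegrableOn (fun p : Fin 3 → ℝ =>
      (p 0 * (1 - p 0) * p 1 * (1 - p 1) * p 2 * (1 - p 2)) ^ n /
        (1 - (1 - p 0 * p 1) * p 2) ^ (n + 1)) {p : Fin 3 → ℝ | ∀ j, p j ∈ Ioo (0 : ℝ) 1} := by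
  refine integrableOn_cube_of_le (C := 1) zero_le_one ?_ ?_
  · exact ContinuousOn.div (Continuous.continuousOn (by fun_prop))
      (Continuous.continuousOn (by fun_prop))
      fun p hp => pow_ne_zero _ (den_pos (hp 0) (hp 1) (hp 2)).ne'
  · intro p hp
    have hD := den_pos (hp 0) (hp 1) (hp 2)
    have hx := hp 0; have hy := hp 1; have hz := hp 2
    have hb0 : 0 ≤ p 0 * (1 - p 0) * p 1 * (1 - p 1) * p 2 * (1 - p 2) := by
      have := hx.1; have := hy.1; have := hz.1
      have : 0 ≤ 1 - p 0 := by linarith [hx.2]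
      have : 0 ≤ 1 - p 1 := by linarith [hy.2]
      have : 0 ≤ 1 - p 2 := by linarith [hz.2]
      positivity
    have hb1 : p 0 * (1 - p 0) * p 1 * (1 - p 1) * p 2 * (1 - p 2) ≤
        1 - (1 - p 0 * p 1) * p 2 := by
      have h1 : p 0 * (1 - p 0) ≤ 1 := by nlinarith [hx.1, hx.2]
      have h2 : p 1 * (1 - p 1) ≤ 1 := by nlinarith [hy.1, hy.2]
      have h3 : p 0 * (1 - p 0) * (p 1 * (1 - p 1)) ≤ 1 := by
        calc p 0 * (1 - p 0) * (p 1 * (1 - p 1)) ≤ 1 * 1 :=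
              mul_le_mul h1 h2 (by nlinarith [hy.1, hy.2]) zero_le_one
          _ = 1 := by ring
      have h4 : 0 ≤ p 2 * (1 - p 2) := by nlinarith [hz.1, hz.2]
      calc p 0 * (1 - p 0) * p 1 * (1 - p 1) * p 2 * (1 - p 2)
          = (p 0 * (1 - p 0) * (p 1 * (1 - p 1))) * (p 2 * (1 - p 2)) := by ring
        _ ≤ 1 * (p 2 * (1 - p 2)) := mul_le_mul_of_nonneg_right h3 h4
        _ ≤ 1 - p 2 := by nlinarith [hz.1, hz.2]
        _ ≤ 1 - (1 - p 0 * p 1) * p 2 := one_sub_le_den hx hy hz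
    rw [abs_div, abs_of_pos (pow_pos hD _), abs_of_nonneg (pow_nonneg hb0 _)]
    refine div_pow_succ_le_div n hD ?_
    rw [one_mul]
    exact pow_le_pow_left₀ hb0 hb1 n

/-! ### The three slice identities -/

/-- Step 2 of the printed proof (`n` integrations by parts in `x`), slice-wise: for
`(y, z) ∈ (0,1)²`, `∫₀¹ F₁(x,y,z) dx = ∫₀¹ F₂(x,y,z) dx`.
[cite: AndrewsAskeyRoy1999, Lemma 7.7.4 (proof)] -/
theorem slice_F₁_F₂ (n : ℕ) (q : Fin 2 → ℝ) (hq : ∀ j, q j ∈ Ioo (0 : ℝ) 1) :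
    ∫ t in (0 : ℝ)..1, (fun p : Fin 3 → ℝ =>
      aeval (p 0) (shiftedLegendre n) * aeval (p 1) (shiftedLegendre n) /
        (1 - (1 - p 0 * p 1) * p 2)) (Fin.insertNth 0 t q) =
    ∫ t in (0 : ℝ)..1, (fun p : Fin 3 → ℝ =>
      (p 0 * p 1 * p 2) ^ n * (1 - p 0) ^ n * aeval (p 1) (shiftedLegendre n) /
        (1 - (1 - p 0 * p 1) * p 2) ^ (n + 1)) (Fin.insertNth 0 t q) := by
  have hy := hq 0
  have hz := hq 1
  simp only [insertNth_zero_eq, Matrix.cons_val_zero, Matrix.cons_val_one, Matrix.cons_val_two,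
    Matrix.head_cons, Matrix.tail_cons]
  have hc : 0 < 1 - q 1 := by linarith [hz.2]
  have hb : 0 ≤ q 0 * q 1 := (mul_pos hy.1 hz.1).le
  have key := integral_shiftedLegendre_div_linear n hc hb
  calc ∫ t in (0 : ℝ)..1, aeval t (shiftedLegendre n) * aeval (q 0) (shiftedLegendre n) /
          (1 - (1 - t * q 0) * q 1)
      = ∫ t in (0 : ℝ)..1, aeval (q 0) (shiftedLegendre n) *
          (aeval t (shiftedLegendre n) / (1 - q 1 + q 0 * q 1 * t)) := by
        refine intervalIntegral.integral_congr fun t _ => ?_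
        have : 1 - (1 - t * q 0) * q 1 = 1 - q 1 + q 0 * q 1 * t := by ring
        rw [this]
        ring
    _ = aeval (q 0) (shiftedLegendre n) *
          ∫ t in (0 : ℝ)..1, t ^ n * (1 - t) ^ n * (q 0 * q 1) ^ n /
            (1 - q 1 + q 0 * q 1 * t) ^ (n + 1) := by
        rw [intervalIntegral.integral_const_mul, key]
    _ = ∫ t in (0 : ℝ)..1, (t * q 0 * q 1) ^ n * (1 - t) ^ n * aeval (q 0) (shiftedLegendre n) /
          (1 - (1 - t * q 0) * q 1) ^ (n + 1) := by
        rw [← intervalIntegral.integral_const_mul]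
        refine intervalIntegral.integral_congr fun t _ => ?_
        have : 1 - (1 - t * q 0) * q 1 = 1 - q 1 + q 0 * q 1 * t := by ring
        rw [this]
        ring

/-- Step 3 of the printed proof (the substitution `w = (1-z)/(1-(1-xy)z)`), slice-wise: for
`(x, y) ∈ (0,1)²`, `∫₀¹ F₂(x,y,z) dz = ∫₀¹ F₃(x,y,w) dw`.
[cite: AndrewsAskeyRoy1999, Lemma 7.7.4 (proof)] -/
theorem slice_F₂_F₃ (n : ℕ) (q : Fin 2 → ℝ) (hq : ∀ j, q j ∈ Ioo (0 : ℝ) 1) :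
    ∫ t in (0 : ℝ)..1, (fun p : Fin 3 → ℝ =>
      (p 0 * p 1 * p 2) ^ n * (1 - p 0) ^ n * aeval (p 1) (shiftedLegendre n) /
        (1 - (1 - p 0 * p 1) * p 2) ^ (n + 1)) (Fin.insertNth 2 t q) =
    ∫ t in (0 : ℝ)..1, (fun p : Fin 3 → ℝ =>
      (1 - p 0) ^ n * (1 - p 2) ^ n * aeval (p 1) (shiftedLegendre n) /
        (1 - (1 - p 0 * p 1) * p 2)) (Fin.insertNth 2 t q) := by
  have hx := hq 0
  have hy := hq 1
  simp only [insertNth_two_eq, Matrix.cons_val_zero, Matrix.cons_val_one, Matrix.cons_val_two,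
    Matrix.head_cons, Matrix.tail_cons]
  have ha0 : 0 < q 0 * q 1 := mul_pos hx.1 hy.1
  have ha1 : q 0 * q 1 < 1 := by nlinarith [hx.1, hx.2, hy.1, hy.2]
  have key := integral_substitution_beukers n ha0 ha1
  calc ∫ t in (0 : ℝ)..1, (q 0 * q 1 * t) ^ n * (1 - q 0) ^ n * aeval (q 1) (shiftedLegendre n) /
          (1 - (1 - q 0 * q 1) * t) ^ (n + 1)
      = ∫ t in (0 : ℝ)..1, (1 - q 0) ^ n * aeval (q 1) (shiftedLegendre n) *
          ((q 0 * q 1) ^ n * t ^ n / (1 - (1 - q 0 * q 1) * t) ^ (n + 1)) := by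
        refine intervalIntegral.integral_congr fun t _ => ?_
        ring
    _ = (1 - q 0) ^ n * aeval (q 1) (shiftedLegendre n) *
          ∫ t in (0 : ℝ)..1, (1 - t) ^ n / (1 - (1 - q 0 * q 1) * t) := by
        rw [intervalIntegral.integral_const_mul, key]
    _ = ∫ t in (0 : ℝ)..1, (1 - q 0) ^ n * (1 - t) ^ n * aeval (q 1) (shiftedLegendre n) /
          (1 - (1 - q 0 * q 1) * t) := by
        rw [← intervalIntegral.integral_const_mul]
        refine intervalIntegral.integral_congr fun t _ => ?_
        ring

/-- Step 4 of the printed proof (`n` integrations by parts in `y`), slice-wise: for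
`(x, w) ∈ (0,1)²`, `∫₀¹ F₃(x,y,w) dy = ∫₀¹ F₄(x,y,w) dy`.
[cite: AndrewsAskeyRoy1999, Lemma 7.7.4 (proof), (7.7.3)] -/
theorem slice_F₃_F₄ (n : ℕ) (q : Fin 2 → ℝ) (hq : ∀ j, q j ∈ Ioo (0 : ℝ) 1) :
    ∫ t in (0 : ℝ)..1, (fun p : Fin 3 → ℝ =>
      (1 - p 0) ^ n * (1 - p 2) ^ n * aeval (p 1) (shiftedLegendre n) /
        (1 - (1 - p 0 * p 1) * p 2)) (Fin.insertNth 1 t q) =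
    ∫ t in (0 : ℝ)..1, (fun p : Fin 3 → ℝ =>
      (p 0 * (1 - p 0) * p 1 * (1 - p 1) * p 2 * (1 - p 2)) ^ n /
        (1 - (1 - p 0 * p 1) * p 2) ^ (n + 1)) (Fin.insertNth 1 t q) := by
  have hx := hq 0
  have hw := hq 1
  simp only [insertNth_one_eq, Matrix.cons_val_zero, Matrix.cons_val_one, Matrix.cons_val_two,
    Matrix.head_cons, Matrix.tail_cons]
  have hc : 0 < 1 - q 1 := by linarith [hw.2]
  have hb : 0 ≤ q 0 * q 1 := (mul_pos hx.1 hw.1).le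
  have key := integral_shiftedLegendre_div_linear n hc hb
  calc ∫ t in (0 : ℝ)..1, (1 - q 0) ^ n * (1 - q 1) ^ n * aeval t (shiftedLegendre n) /
          (1 - (1 - q 0 * t) * q 1)
      = ∫ t in (0 : ℝ)..1, (1 - q 0) ^ n * (1 - q 1) ^ n *
          (aeval t (shiftedLegendre n) / (1 - q 1 + q 0 * q 1 * t)) := by
        refine intervalIntegral.integral_congr fun t _ => ?_
        have : 1 - (1 - q 0 * t) * q 1 = 1 - q 1 + q 0 * q 1 * t := by ring
        rw [this]
        ring
    _ = (1 - q 0) ^ n * (1 - q 1) ^ n *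
          ∫ t in (0 : ℝ)..1, t ^ n * (1 - t) ^ n * (q 0 * q 1) ^ n /
            (1 - q 1 + q 0 * q 1 * t) ^ (n + 1) := by
        rw [intervalIntegral.integral_const_mul, key]
    _ = ∫ t in (0 : ℝ)..1, (q 0 * (1 - q 0) * t * (1 - t) * q 1 * (1 - q 1)) ^ n /
          (1 - (1 - q 0 * t) * q 1) ^ (n + 1) := by
        rw [← intervalIntegral.integral_const_mul]
        refine intervalIntegral.integral_congr fun t _ => ?_
        have : 1 - (1 - q 0 * t) * q 1 = 1 - q 1 + q 0 * q 1 * t := by ring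
        rw [this]
        simp only [mul_pow]
        ring

/-! ### Assembly -/

/-- Step 1 of the printed proof: by `-log(xy)/(1-xy) = ∫₀¹ dz/(1-(1-xy)z)` and Fubini,
`∫∫ -log(xy)/(1-xy) pₙ(x)pₙ(y) = ∫∫∫ F₁`. [cite: AndrewsAskeyRoy1999, Lemma 7.7.4 (proof)] -/
theorem legendreLogIntegral_eq_integral_F₁ (n : ℕ) :
    legendreLogIntegral n = ∫ p in {p : Fin 3 → ℝ | ∀ j, p j ∈ Ioo (0 : ℝ) 1},
      aeval (p 0) (shiftedLegendre n) * aeval (p 1) (shiftedLegendre n) /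
        (1 - (1 - p 0 * p 1) * p 2) := by
  rw [legendreLogIntegral, integral_cube_eq_integral_square_integral 2 _ (integrableOn_F₁ n)]
  refine setIntegral_congr_fun (measurableSet_cube 2) fun q hq => ?_
  have hx := hq 0
  have hy := hq 1
  simp only [insertNth_two_eq, Matrix.cons_val_zero, Matrix.cons_val_one, Matrix.cons_val_two,
    Matrix.head_cons, Matrix.tail_cons]
  have ha0 : 0 < 1 - q 0 * q 1 := by nlinarith [hx.1, hx.2, hy.1, hy.2]
  have ha1 : 1 - q 0 * q 1 < 1 := by nlinarith [mul_pos hx.1 hy.1]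
  have hker := integral_one_div_one_sub_mul ha0 ha1
  rw [sub_sub_cancel] at hker
  rw [intervalIntegral.integral_of_le zero_le_one, integral_Ioc_eq_integral_Ioo] at hker
  have : (fun t : ℝ => aeval (q 0) (shiftedLegendre n) * aeval (q 1) (shiftedLegendre n) /
        (1 - (1 - q 0 * q 1) * t)) =
      fun t : ℝ => aeval (q 0) (shiftedLegendre n) * aeval (q 1) (shiftedLegendre n) *
        (1 / (1 - (1 - q 0 * q 1) * t)) := by
    funext t
    rw [mul_one_div]
  rw [this, MeasureTheory.integral_const_mul, hker]
  ring

/-- **Beukers' integral identity** (Andrews–Askey–Roy, Lemma 7.7.4 with (7.7.3); Beukers 1979):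
`∫₀¹∫₀¹ -log(xy)/(1-xy) pₙ(x)pₙ(y) dx dy = ∫₀¹∫₀¹∫₀¹ (x(1-x)y(1-y)w(1-w))ⁿ/(1-(1-xy)w)ⁿ⁺¹ dx dy dw`
— discharge of the named fact `legendreLogIntegral_eq_tripleIntegral`.
[cite: AndrewsAskeyRoy1999, Lemma 7.7.4 and (7.7.3)] -/
theorem legendreLogIntegral_eq_tripleIntegral_holds : legendreLogIntegral_eq_tripleIntegral := by
  intro n
  rw [legendreLogIntegral_eq_integral_F₁ n, tripleIntegral]
  exact (integral_cube_congr_slice 0 (integrableOn_F₁ n) (integrableOn_F₂ n) (slice_F₁_F₂ n)).trans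
    ((integral_cube_congr_slice 2 (integrableOn_F₂ n) (integrableOn_F₃ n) (slice_F₂_F₃ n)).trans
      (integral_cube_congr_slice 1 (integrableOn_F₃ n) (integrableOn_F₄ n) (slice_F₃_F₄ n)))

end Beukers

end Literature.NumberTheory.Transcendental

end
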